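import Summits.ValiantsHypothesis.ValiantsHypothesis.Theorems.BarrierLeverChowThinRowsAllColumns
import Literature.Barriers.ValiantsHypothesis.BDGIL24AffineInputsVP

/-!
# Route BarrierLever — items `ChowHitsThinRowPartitionMinors` (stmt-ValiantsHypothesis-20195) and
# `PartitionMinorsHitByVP` (stmt-ValiantsHypothesis-19717): their FIRST-ORDER slices, unconditionally

Helper file (`--supports stmt-ValiantsHypothesis-20195`; cell valiant-natproofs, rung V4, 𝒟-side of
door (c); prover seat val-np-p7 gen 4).  Closes NO item; imports `…ChowThinRowsAllColumns` (val-np-p7 g4,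
the all-columns first-order-rows theorem) and the route-independent Literature module
`Literature.Barriers.ValiantsHypothesis.BDGIL24AffineInputsVP` (`SmallCircuits`, the gate count of an
affine form `BergEtAl2024.complexity_le_of_totalDegree_le_one`, `complexity_finset_prod_le`); no
definitions, no route file in the import cone.

* `chowHitsThinRowPartitionMinors_firstOrder` — item 20195's statement VERBATIM with the row bound
  `(u i).card ≤ 2` replaced by `(u i).card ≤ 1` (threshold `h₀ = 1`): the whole first-order layer of
  thin-row CPM holds, for arbitrary columns.
* `partitionMinorsHitByVP_firstOrder` — item 19717's statement VERBATIM restricted to layouts whose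
  rows have size `≤ 1` (size exponent `b = 3`, threshold `h₀ = 2`): every such partition minor is hit by
  a small circuit (the product of affine forms itself), with NO hypothesis — the 𝒟-side door (c) on all
  first-order layouts, including every capacity counterexample to the refuted universal-witness
  statements (TNS / TT / CT / PP: rows `∅` + singletons against block columns).

WHAT THIS IS NOT: rows of size `2` are not covered (pair layer of 20195 open); items 20195 / 20172 /
19717 are NOT proved; nothing on crux stmt-ValiantsHypothesis-14610 or `VP` versus `VNP`.
-/

set_option linter.dupNamespace false

namespace Summit.ValiantsHypothesis.ValiantsHypothesis.Theorems.BarrierLever.ChowThinAll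

open MvPolynomial Literature.Barriers.ValiantsHypothesis Literature.Computability.AlgebraicComplexity

/-- **First-order layer of item 20195, all columns**: item `ChowHitsThinRowPartitionMinors` verbatim
with the row-size bound `2` replaced by `1` — for every `h ≥ 1`, every injective layout with rows of
size `≤ 1` has a product of `h + h` affine forms with nonsingular partition minor. -/
theorem chowHitsThinRowPartitionMinors_firstOrder :
    ∃ h₀ : ℕ, ∀ h : ℕ, h₀ ≤ h → ∀ (r : ℕ) (u w : Fin r → Finset (Fin h)),
      Function.Injective u → Function.Injective w → (∀ i, (u i).card ≤ 1) →
        ∃ ℓ : Fin (h + h) → MvPolynomial (Fin (h + h)) ℂ, (∀ k, (ℓ k).totalDegree ≤ 1) ∧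
          (Matrix.of fun i j : Fin r => MvPolynomial.coeff
            (∑ a ∈ u i, Finsupp.single (Fin.castAdd h a) 1 +
              ∑ c ∈ w j, Finsupp.single (Fin.natAdd h c) 1) (∏ k, ℓ k)).det ≠ 0 :=
  ⟨1, fun h hh r u w hu hw hu1 => chowHits_firstOrderRows h hh r u w hu hw hu1⟩

/-- **First-order slice of item 19717, unconditionally**: item `PartitionMinorsHitByVP` verbatim
restricted to layouts whose rows have size `≤ 1` — with size exponent `b = 3` and threshold `h₀ = 2`,
every such partition minor is hit by some `f ∈ SmallCircuits ℂ (h+h) 3` (the product of affine forms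
of `chowHits_firstOrderRows`: degree `≤ h+h`, size `≤ (h+h)(2(h+h)+1) + (h+h) ≤ (h+h)³`, the bookkeeping
of `ChowLadder.prod_affine_mem_smallCircuits` redone inline to keep the route file out of the imports).
[cite: ForbesShpilkaVolk2018, §8] -/
theorem partitionMinorsHitByVP_firstOrder :
    ∃ b h₀ : ℕ, ∀ h : ℕ, h₀ ≤ h → ∀ (r : ℕ) (u w : Fin r → Finset (Fin h)),
      Function.Injective u → Function.Injective w → (∀ i, (u i).card ≤ 1) →
        ∃ f ∈ SmallCircuits ℂ (h + h) b,
          (Matrix.of fun i j : Fin r => MvPolynomial.coeff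
            (∑ a ∈ u i, Finsupp.single (Fin.castAdd h a) 1 +
              ∑ c ∈ w j, Finsupp.single (Fin.natAdd h c) 1) f).det ≠ 0 := by
  refine ⟨3, 2, fun h hh r u w hu hw hu1 => ?_⟩
  obtain ⟨ℓ, hℓ, hdet⟩ := chowHits_firstOrderRows h (by omega) r u w hu hw hu1
  have h3 : 3 ≤ h + h := by omega
  refine ⟨∏ k, ℓ k, ⟨?_, ?_⟩, hdet⟩
  · calc (∏ k, ℓ k).totalDegree ≤ ∑ k, (ℓ k).totalDegree := totalDegree_finsetProd _ _
      _ ≤ ∑ _k : Fin (h + h), 1 := Finset.sum_le_sum fun k _ => hℓ k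
      _ = h + h := by simp
  · have hterm : ∀ k, complexity (ℓ k) ≤ 2 * (h + h) + 1 := fun k => by
      simpa [Fintype.card_fin] using BergEtAl2024.complexity_le_of_totalDegree_le_one (hℓ k)
    calc complexity (∏ k, ℓ k)
        ≤ ∑ k, complexity (ℓ k) + (Finset.univ : Finset (Fin (h + h))).card :=
          complexity_finset_prod_le _ _
      _ ≤ ∑ _k : Fin (h + h), (2 * (h + h) + 1) + (h + h) := by
          rw [Finset.card_univ, Fintype.card_fin]
          exact Nat.add_le_add_right (Finset.sum_le_sum fun k _ => hterm k) _
      _ = (h + h) * (2 * (h + h) + 1) + (h + h) := by simp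
      _ ≤ (h + h) ^ 3 := by
          have h2 : 3 * ((h + h) * (h + h)) ≤ (h + h) * ((h + h) * (h + h)) :=
            Nat.mul_le_mul_right ((h + h) * (h + h)) h3
          calc (h + h) * (2 * (h + h) + 1) + (h + h) = 2 * ((h + h) * (h + h)) + 2 * (h + h) := by ring
            _ ≤ 3 * ((h + h) * (h + h)) := by nlinarith
            _ ≤ (h + h) * ((h + h) * (h + h)) := h2
            _ = (h + h) ^ 3 := by ring

end Summit.ValiantsHypothesis.ValiantsHypothesis.Theorems.BarrierLever.ChowThinAll
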